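import Mathlib.Topology.MetricSpace.Polish
import Mathlib.Topology.MetricSpace.Completion
import Mathlib.Topology.Metrizable.Urysohn
import HarnessLib

/-!
# Locally compact second countable Hausdorff spaces are Polish
(Kechris, *Classical Descriptive Set Theory* (1995), Thm. 5.3; Bourbaki, *Topologie générale*,
IX §6.1, Cor. of Prop. 2)

A locally compact, second countable Hausdorff space `X` is *Polish* (separable and completely
metrizable). Mathlib knows that `X` is metrizable (Urysohn: `T₃` and second countable,
`TopologicalSpace.metrizableSpace_of_t3_secondCountable`) but does not record complete
metrizability; we PROVE it (`polishSpace_of_locallyCompactSpace_of_secondCountableTopology`) by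
the classical argument: for a compatible metric, `X` is *open* in its (complete, separable, hence
Polish) metric completion `X̂` — a point `x` has a compact neighbourhood `K`, whose image in `X̂` is
compact hence closed, and an open `V ⊆ X̂` with `V ∩ X` inside `K`; as `X` is dense in `X̂`,
`V ⊆ closure (V ∩ X) ⊆ K ⊆ X` — and open subspaces of Polish spaces are Polish (Mathlib
`IsOpen.polishSpace`), transported back to `X` along the isometric embedding `X ≃ₜ X ⊆ X̂`.

This is the point-set input that makes Borel structures on coset spaces `G ⧸ H` of locally compact
second countable groups tractable (Mathlib `Continuous.map_eq_borel`: for a continuous surjection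
from a Polish space onto a `T₀` second countable space the quotient σ-algebra is the Borel one);
it is used by `Literature.MeasureTheory.Group` for Weil's integration formula on `G ⧸ H`.

## References

* A. S. Kechris, *Classical Descriptive Set Theory*, GTM 156 (1995), Thm. 5.3 (locally compact
  metrizable [second countable] spaces are Polish).
* N. Bourbaki, *Topologie générale*, Ch. IX §6.1.
-/

noncomputable section

open _root_.Topology _root_.TopologicalSpace Set Filter

namespace Literature.Topology.Metrizable

/-- **A locally compact metric space is open in its completion.** For a metric space `X` whose
topology is locally compact, the range of the canonical isometry `X → X̂` into the metric
completion is open: if `K` is a compact neighbourhood of `x` and `V ⊆ X̂` is open with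
`V ∩ X ⊆ K` and `x ∈ V`, then `V ⊆ closure (V ∩ X) ⊆ K ⊆ X` since `X` is dense in `X̂` and the
image of `K` is closed. [folklore] -/
theorem isOpen_range_coe_completion (X : Type*) [MetricSpace X] [LocallyCompactSpace X] :
    IsOpen (Set.range ((↑) : X → UniformSpace.Completion X)) := by
  have hι : Isometry ((↑) : X → UniformSpace.Completion X) := UniformSpace.Completion.coe_isometry
  have hd : DenseRange ((↑) : X → UniformSpace.Completion X) :=
    UniformSpace.Completion.denseRange_coe
  rw [isOpen_iff_mem_nhds]
  rintro _ ⟨x, rfl⟩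
  obtain ⟨K, hK, hxK⟩ := exists_compact_mem_nhds x
  obtain ⟨U, hUK, hUo, hxU⟩ := mem_nhds_iff.1 hxK
  obtain ⟨V, hVo, hVU⟩ := hι.isEmbedding.isInducing.isOpen_iff.1 hUo
  -- `V ⊆ range coe`
  have hVsub : V ⊆ Set.range ((↑) : X → UniformSpace.Completion X) := by
    have h1 : V ⊆ closure (V ∩ Set.range ((↑) : X → UniformSpace.Completion X)) :=
      hd.open_subset_closure_inter hVo
    have h2 : V ∩ Set.range ((↑) : X → UniformSpace.Completion X) =
        ((↑) : X → UniformSpace.Completion X) '' U := by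
      rw [← hVU, Set.image_preimage_eq_inter_range]
    have h3 : closure (((↑) : X → UniformSpace.Completion X) '' U) ⊆
        ((↑) : X → UniformSpace.Completion X) '' K := by
      rw [← ((hK.image hι.continuous).isClosed).closure_eq]
      exact closure_mono (Set.image_mono hUK)
    rw [h2] at h1
    exact h1.trans (h3.trans (Set.image_subset_range _ _))
  have hxV : ((x : X) : UniformSpace.Completion X) ∈ V := by
    have : x ∈ ((↑) : X → UniformSpace.Completion X) ⁻¹' V := by rw [hVU]; exact hxU
    exact this
  exact Filter.mem_of_superset (hVo.mem_nhds hxV) hVsub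

/-- **Locally compact second countable Hausdorff spaces are Polish** (Kechris (1995), Thm. 5.3).
Proof: `X` is `T₃` and second countable, hence metrizable (Urysohn); for a compatible metric it is
open in its complete separable metric completion (`isOpen_range_coe_completion`), and open
subspaces of Polish spaces are Polish (`IsOpen.polishSpace`), transported along the homeomorphism
`X ≃ₜ range`. A theorem, not an instance (the hypotheses are common instances and an instance
would fire everywhere). [folklore] -/
theorem polishSpace_of_locallyCompactSpace_of_secondCountableTopology (X : Type*)
    [TopologicalSpace X] [LocallyCompactSpace X] [SecondCountableTopology X] [T2Space X] :
    PolishSpace X := by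
  letI : MetricSpace X := TopologicalSpace.metrizableSpaceMetric X
  have hι : Isometry ((↑) : X → UniformSpace.Completion X) := UniformSpace.Completion.coe_isometry
  have hd : DenseRange ((↑) : X → UniformSpace.Completion X) :=
    UniformSpace.Completion.denseRange_coe
  -- the completion is Polish
  haveI : SeparableSpace (UniformSpace.Completion X) := hd.separableSpace hι.continuous
  haveI : PolishSpace (UniformSpace.Completion X) := inferInstance
  -- its open subspace `range coe` is Polish
  haveI : PolishSpace (Set.range ((↑) : X → UniformSpace.Completion X)) :=
    (isOpen_range_coe_completion X).polishSpace
  -- and `X` is homeomorphic to it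
  exact (hι.isEmbedding.toHomeomorph).isClosedEmbedding.polishSpace

end Literature.Topology.Metrizable
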